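import Summits.QuantumFields.YangMills.Theorems.ParabolicTrajectoryContinuumLimitOnTrajectoryDefs

/-!
# Route `ParabolicTrajectory`, crux `ContinuumLimitOnTrajectory` (stmt-QuantumFields-10522): vocabulary of line `two-orbit-synchronisation`, part B (reshape after wave 1)

Second route-posited vocabulary file of the line (lead `prover-line-stmt-QuantumFields-10522-0`), same namespace as
`ParabolicTrajectoryContinuumLimitOnTrajectoryDefs`. Wave 1 of the line proved `stub_sync` and `stub_anatomy` and
returned three determinations that force a RESHAPE of the skeleton; this file carries the vocabulary of the
reshaped stubs. NOTHING here is asserted except the registered elementary glue of §1 (proved):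
* §1 (proved glue) `blockDilate_iterate_apply`, `curvNPoint_eq_wilsonCentredSchwinger` — the case `L = L_k` of the
  old volume stub is an exact identity (`c a⁴ = a⁻⁴a⁴ = 1`, `f(a_k x) = ((blockDilate M)^[n_k] f) x`) — and
  `eventually_rate_le` (`C e^{-μ a_k L_k} ≤ ε` eventually, from `a_k L_k → ∞`).
* §2 `ScaledFiniteSize r M sch n` — the SCALED finite-size clause at the sequence points that the crux's
  hypothesis (ii) `HasLatticeMassGap` (an UNSCALED decay bound, per observable pair) does not supply (wave-1
  determination of `stub_volume`; Disproof §R F3): the content of the new open stub `FiniteSizeLeg` (§4), from which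
  the old `VolumeIndependence` follows by §1 (`volumeIndependence_of_scaledFiniteSize`, proved).
* §3 `ARP r sch` (approximate reflection positivity of the canonical curvature distributions — NOT exact Wilson RP:
  the corner action density is time-chiral) and `UCL r sch` (`k`-uniform qualitative spatial clustering in the E4
  format) — the two inputs under which the OS-legs packaging is PROVED (`OneFieldOSLegs'`, wave-1 determination of
  `stub_osLegs`; its proof lands in the `…StubOSLegs{A,B,C,D}` files).
* §4 the reshaped stub statements `FiniteSizeLeg` (IR: thermodynamic-limit RATE at scale, open), `UVRegularity`
  (UV: the old `LimitRegularity` plus `ARP`, open), `ClusteringLeg` (IR: `UCL` from the gap leg, open),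
  `OneFieldOSLegs'` (proved downstream).
Refs: line card `Lines/two-orbit-synchronisation.md`; OsterwalderSeiler1978 §§2–3; OsterwalderSchrader1975 §2;
GlimmJaffe1987 §6.1.
-/

set_option autoImplicit false

open scoped SchwartzMap
open MeasureTheory Filter Topology
open Literature.MathematicalPhysics.QuantumFieldTheory Literature.MathematicalPhysics.QuantumLattice
open Literature.MathematicalPhysics.AQFT Literature.Probability.LatticeModels
open Summit.QuantumFields.YangMills.Theses.ParabolicTrajectory

noncomputable section

namespace Summit.QuantumFields.YangMills.Cruxes.ContinuumLimitOnTrajectory.TwoOrbitSynchronisation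

local notation "𝔼" => EuclideanSpace ℝ (Fin 4)

/-! ## §1 Registered glue (proved): the `L = L_k` identity -/

/-- Iterated block dilation: `((blockDilate M)^[n] f) x = f ((M ^ n)⁻¹ • x)` for `M ≠ 0`. -/
theorem blockDilate_iterate_apply {M : ℕ} (hM : M ≠ 0) (n : ℕ) (f : 𝓢(𝔼, ℝ)) (x : 𝔼) :
    ((blockDilate M)^[n] f) x = f ((((M : ℝ) ^ n)⁻¹) • x) := by
  induction n generalizing x with
  | zero => simp
  | succ n ih =>
    rw [Function.iterate_succ_apply', blockDilate_apply hM, ih, smul_smul, pow_succ, mul_inv]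

section Identity

variable {G : Type} [Group G] [TopologicalSpace G] [IsTopologicalGroup G] [CompactSpace G]
  [MeasurableSpace G] [BorelSpace G]

/-- `canon` keeps the spacings. -/
@[simp] theorem canon_a' (r : LatticeRep G) (sch : SpeciesScheme (YMSpecies G)) : (canon r sch).a = sch.a := rfl
/-- `canon` keeps the couplings. -/
@[simp] theorem canon_β' (r : LatticeRep G) (sch : SpeciesScheme (YMSpecies G)) : (canon r sch).β = sch.β := rfl
/-- `canon` keeps the torus half-sides. -/
@[simp] theorem canon_L' (r : LatticeRep G) (sch : SpeciesScheme (YMSpecies G)) : (canon r sch).L = sch.L := rfl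
/-- `canon` keeps the torus sides `2L_k+1`. -/
theorem canon_side (r : LatticeRep G) (sch : SpeciesScheme (YMSpecies G)) (k : ℕ) :
    (canon r sch).side k = 2 * sch.L k + 1 := rfl
/-- `canon` centres by the torus Wilson mean. -/
theorem canon_m (r : LatticeRep G) (sch : SpeciesScheme (YMSpecies G)) (s : YMSpecies G) (k : ℕ) :
    (canon r sch).m s k = wilsonTorusMean r.ρ (sch.β k) (sch.L k) s.F := rfl
/-- `canon` weighs the curvature species by `a_k⁻⁴`. -/
theorem canon_c_curvature (r : LatticeRep G) (sch : SpeciesScheme (YMSpecies G)) (k : ℕ) :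
    (canon r sch).c r.curvature k = ((sch.a k) ^ 4)⁻¹ := by
  simp [canon]

end Identity

section IdentityGlue

variable {G : Type} [Group G] [TopologicalSpace G] [IsTopologicalGroup G] [CompactSpace G]
  [MeasurableSpace G] [BorelSpace G]

/-- Pointwise form of the identity: the canonically weighted smeared field at spacing `a_k = (M^n)⁻¹` equals the
unit-spacing, unit-weight smeared field of the `n`-fold block-dilated test function. -/
theorem smearedLatticeField_canon_eq (r : LatticeRep G) (sch : SpeciesScheme (YMSpecies G)) {M : ℕ} (hM : M ≠ 0)
    {k n : ℕ} (hshape : sch.a k = ((M : ℝ) ^ n)⁻¹) (f : 𝓢(EuclideanSpace ℝ (Fin 4), ℝ)) (V : LGConfig 4 G) :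
    smearedLatticeField r.curvature.F (box 4 (sch.L k)) (sch.a k) (((sch.a k) ^ 4)⁻¹)
        (wilsonTorusMean r.ρ (sch.β k) (sch.L k) r.curvature.F) f V =
      smearedLatticeField r.curvature.F (box 4 (sch.L k)) 1 1
        (wilsonTorusMean r.ρ (sch.β k) (sch.L k) r.curvature.F) ((blockDilate M)^[n] f) V := by
  have ha : sch.a k ≠ 0 := (sch.a_pos k).ne'
  simp only [smearedLatticeField]
  rw [inv_mul_cancel₀ (pow_ne_zero 4 ha)]
  simp only [one_smul, one_pow, mul_one, one_mul, blockDilate_iterate_apply hM, hshape]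

end IdentityGlue

/-- **The `L = L_k` case of the old volume stub is an exact identity** (REGISTERED GLUE of the reshaped skeleton).
Under the `M`-adic shape `a_k = (M^{n})⁻¹` (`M ≠ 0`), the canonical curvature `p`-point function at step `k` IS the
unit-normalised centred Wilson `p`-point function on the scheme's own torus `2L_k+1` with `n`-fold block-dilated
test functions (`c a⁴ = a⁻⁴ a⁴ = 1`, `m = wilsonTorusMean`, `f (a_k • x) = ((blockDilate M)^[n] f) x`). -/
theorem curvNPoint_eq_wilsonCentredSchwinger :
    ∀ {G : Type} [Group G] [TopologicalSpace G] [IsTopologicalGroup G] [CompactSpace G]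
      [MeasurableSpace G] [BorelSpace G] (r : LatticeRep G) (sch : SpeciesScheme (YMSpecies G)) {M : ℕ},
      M ≠ 0 → ∀ {k n : ℕ}, sch.a k = ((M : ℝ) ^ n)⁻¹ → ∀ (p : ℕ) (f : Fin p → 𝓢(EuclideanSpace ℝ (Fin 4), ℝ)),
        curvNPoint r sch k p f =
          wilsonCentredSchwinger r.ρ (sch.β k) (sch.L k) (fun _ => 1) p (fun _ => r.curvature)
            (fun i => (blockDilate M)^[n] (f i)) := by
  intro G _ _ _ _ _ _ r sch M hM k n hshape p f
  have key := fun (V : LGConfig 4 G) (i : Fin p) => smearedLatticeField_canon_eq r sch hM hshape (f i) V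
  unfold curvNPoint latticeSchwinger wilsonCentredSchwinger
  simp only [canon_a', canon_β', canon_L', canon_side, canon_m, canon_c_curvature, key]
  rfl



/-! ## §2 The scaled finite-size clause -/

section FiniteSize

variable {G : Type} [Group G] [TopologicalSpace G] [IsTopologicalGroup G] [CompactSpace G]
  [MeasurableSpace G] [BorelSpace G]

/-- **Scaled finite-size clause** along an `M`-adic scheme (the missing hypothesis; NOT implied by
`HasLatticeMassGap`, which is an UNSCALED decay bound). Between the scheme's torus `2L_k+1` and every larger odd
torus, (i) the unit-normalised centred Wilson `p`-point functions with `n_k`-fold block-dilated off-diagonal test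
functions and (ii) the `a_k⁻⁸ = (M^{n_k})⁸`-SCALED point-split curvature correlators at physical separation `t`
differ by at most `C e^{-μ a_k L_k}`: finite-size corrections exponentially small in the PHYSICAL half-side
`a_k L_k → ∞`, RELATIVE to the physical amplitudes. (A rate-of-thermodynamic-limit statement at scale; no decay
clause — not even an `a_k⁸`-scaled gap bound — implies it.) -/
def ScaledFiniteSize (r : LatticeRep G) (M : ℕ) (sch : SpeciesScheme (YMSpecies G)) (n : ℕ → ℕ) : Prop :=
  ∃ μ : ℝ, 0 < μ ∧
    (∀ (p : ℕ) (f : Fin p → 𝓢(𝔼, ℝ)), IsOffDiagonal (SchwartzMap.tensorFin p fun i => ofRealTest (f i)) →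
      ∃ C : ℝ, ∀ᶠ k in atTop, ∀ L : ℕ, sch.L k ≤ L →
        |wilsonCentredSchwinger r.ρ (sch.β k) (sch.L k) (fun _ => 1) p (fun _ => r.curvature)
              (fun i => (blockDilate M)^[n k] (f i)) -
            wilsonCentredSchwinger r.ρ (sch.β k) L (fun _ => 1) p (fun _ => r.curvature)
              (fun i => (blockDilate M)^[n k] (f i))| ≤ C * Real.exp (-(μ * (sch.a k * sch.L k)))) ∧
    (∀ t : ℕ, 0 < t → ∃ C : ℝ, ∀ᶠ k in atTop, ∀ S : ℕ, sch.L k ≤ S →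
      ((M : ℝ) ^ n k) ^ 8 *
          |latticeConnectedCorr r.ρ (sch.β k) (sch.side k) r.curvature.F r.curvature.F (t * M ^ n k) -
            latticeConnectedCorr r.ρ (sch.β k) (2 * S + 1) r.curvature.F r.curvature.F (t * M ^ n k)| ≤
        C * Real.exp (-(μ * (sch.a k * sch.L k))))

/-- An exponentially small finite-size rate `C e^{-μ a_k L_k}` is eventually below every `ε > 0`
(uses only `a_k L_k → ∞` of the scheme). -/
theorem eventually_rate_le {ι : Type} (sch : SpeciesScheme ι) {μ : ℝ} (hμ : 0 < μ) (C : ℝ) {ε : ℝ}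
    (hε : 0 < ε) : ∀ᶠ k in atTop, C * Real.exp (-(μ * (sch.a k * sch.L k))) ≤ ε := by
  have h : Tendsto (fun k => C * Real.exp (-(μ * (sch.a k * sch.L k)))) atTop (𝓝 (C * 0)) :=
    (Real.tendsto_exp_atBot.comp
      (tendsto_neg_atTop_atBot.comp (sch.tendsto_L.const_mul_atTop hμ))).const_mul C
  rw [mul_zero] at h
  exact h.eventually_le_const hε

/-- **The old volume stub follows from the scaled finite-size clause** (identity at `L = L_k` + the clause +
`a_k L_k → ∞`): both conclusions of `VolumeIndependence` for the given scheme. -/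
theorem volumeIndependence_of_scaledFiniteSize (r : LatticeRep G) {M : ℕ} (sch : SpeciesScheme (YMSpecies G))
    {n : ℕ → ℕ} (hshape : ∀ k, sch.a k = ((M : ℝ) ^ n k)⁻¹) (hfs : ScaledFiniteSize r M sch n) :
    (∀ (p : ℕ) (f : Fin p → 𝓢(𝔼, ℝ)), IsOffDiagonal (SchwartzMap.tensorFin p fun i => ofRealTest (f i)) →
      ∀ ε : ℝ, 0 < ε → ∀ᶠ k in atTop, ∀ L : ℕ, sch.L k ≤ L →
        |curvNPoint r sch k p f -
            wilsonCentredSchwinger r.ρ (sch.β k) L (fun _ => 1) p (fun _ => r.curvature)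
              (fun i => (blockDilate M)^[n k] (f i))| ≤ ε) ∧
    (∀ t : ℕ, 0 < t → ∀ ε : ℝ, 0 < ε → ∀ᶠ k in atTop, ∀ S : ℕ, sch.L k ≤ S →
      ((M : ℝ) ^ n k) ^ 8 *
        |latticeConnectedCorr r.ρ (sch.β k) (sch.side k) r.curvature.F r.curvature.F (t * M ^ n k) -
          latticeConnectedCorr r.ρ (sch.β k) (2 * S + 1) r.curvature.F r.curvature.F (t * M ^ n k)| ≤ ε) := by
  obtain ⟨μ, hμ, hW, hC⟩ := hfs
  have hM : M ≠ 0 := by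
    have := Summit.QuantumFields.YangMills.Theorems.LatticeGapOnTrajectory.Negative.two_le_of_shape sch hshape
    omega
  refine ⟨fun p f hf ε hε => ?_, fun t ht ε hε => ?_⟩
  · obtain ⟨C, hCk⟩ := hW p f hf
    filter_upwards [hCk, eventually_rate_le sch hμ C hε] with k hk hrate L hL
    rw [curvNPoint_eq_wilsonCentredSchwinger r sch hM (hshape k) p f]
    exact (hk L hL).trans hrate
  · obtain ⟨C, hCk⟩ := hC t ht
    filter_upwards [hCk, eventually_rate_le sch hμ C hε] with k hk hrate S hS
    exact (hk S hS).trans hrate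

end FiniteSize

/-! ## §3 The two inputs of the OS-legs packaging -/

section OSInputs

variable {G : Type} [Group G] [TopologicalSpace G] [IsTopologicalGroup G] [CompactSpace G]
  [MeasurableSpace G] [BorelSpace G]

/-- **(ARP) approximate reflection positivity of the canonical curvature distributions**, in the finite-list
format of `LabelledSchwingerFamily.IsReflectionPositive` (degree-`0` terms allowed, which also yields E0
hermiticity in the limit): for time-ordered `F j` and append-tensor witnesses `H i j` of `θ(F i)* ⊗ F j`,
`∑ᵢⱼ curvDistribution k (H i j)` has real part `≥ −ε` and imaginary part `≤ ε` in modulus, eventually in `k`.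
(NOT an instance of exact lattice RP: the corner action density is time-chiral, see the module docstring §2.) -/
def ARP (r : LatticeRep G) (sch : SpeciesScheme (YMSpecies G)) : Prop :=
  ∀ (N : ℕ) (deg : Fin N → ℕ) (F : (j : Fin N) → 𝓢((Fin (deg j) → 𝔼), ℂ)),
    (∀ j, IsTimeOrdered (F j)) →
      ∀ H : (i j : Fin N) → 𝓢((Fin (deg i + deg j) → 𝔼), ℂ),
        (∀ i j, IsAppendTensorOf (H i j) (osAdjoint (F i)) (F j)) →
          ∀ ε : ℝ, 0 < ε → ∀ᶠ k in atTop,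
            -ε ≤ (∑ i, ∑ j, curvDistribution r sch k (deg i + deg j) (H i j)).re ∧
              |(∑ i, ∑ j, curvDistribution r sch k (deg i + deg j) (H i j)).im| ≤ ε

/-- **(UCL) `k`-uniform qualitative spatial clustering of the canonical curvature distributions**, in the format
of `LabelledSchwingerFamily.HasClusterProperty` (E4): for time-ordered `F, G`, spatial `a ≠ 0` and `ε > 0`
there is `t₀` such that for every `t ≥ t₀` and every witness `H` of `θF* ⊗ T_{t a} G`, EVENTUALLY IN `k`,
`‖curvDistribution k (n+m) H − curvDistribution k n (θF*) · curvDistribution k m G‖ ≤ ε`. This is the scaled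
clustering input that `HasLatticeMassGap` (per-species constants, unscaled) cannot supply (docstring §1). -/
def UCL (r : LatticeRep G) (sch : SpeciesScheme (YMSpecies G)) : Prop :=
  ∀ (n m : ℕ) (F : 𝓢((Fin n → 𝔼), ℂ)) (G' : 𝓢((Fin m → 𝔼), ℂ)), IsTimeOrdered F → IsTimeOrdered G' →
    ∀ a : 𝔼, a 0 = 0 → a ≠ 0 → ∀ ε : ℝ, 0 < ε → ∃ t₀ : ℝ, ∀ t : ℝ, t₀ ≤ t →
      ∀ H : 𝓢((Fin (n + m) → 𝔼), ℂ),
        IsAppendTensorOf H (osAdjoint F) (translateMulti (t • a) G') →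
          ∀ᶠ k in atTop,
            ‖curvDistribution r sch k (n + m) H -
                curvDistribution r sch k n (osAdjoint F) * curvDistribution r sch k m G'‖ ≤ ε

end OSInputs

/-! ## §4 The reshaped stub statements -/

/-- **Stub statement — FINITE-SIZE LEG (IR; open).** Along every sequence of the crux's hypothesis block
(compact simple `G`; `M`-adic shape, `β_k → ∞`, all towers convergent, tuning `θ > 0`, `HasLatticeMassGap` with
`Δ > 0`) the SCALED finite-size clause holds. Content: finite-size corrections between the scheme's torus and every
larger one are small RELATIVE to the physical amplitudes (rate of the weak-coupling thermodynamic limit at the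
`a_k⁸` scale); not implied by any decay clause, in particular not by (ii). -/
def FiniteSizeLeg : Prop :=
  ∀ (G : Type) [Group G] [TopologicalSpace G] [IsTopologicalGroup G] [CompactSpace G]
    [MeasurableSpace G] [BorelSpace G], IsCompactSimpleLieGroup G →
    ∀ (r : LatticeRep G) (M : ℕ) (θ Δ : ℝ) (sch : SpeciesScheme (YMSpecies G)) (n : ℕ → ℕ),
    0 < θ → 0 < Δ → (∀ k, sch.a k = ((M : ℝ) ^ n k)⁻¹) → Tendsto sch.β atTop atTop →
    (∀ t : ℕ, 0 < t → ∃ c : ℝ, Tendsto (fun k => ((M : ℝ) ^ n k) ^ 8 *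
      latticeConnectedCorr r.ρ (sch.β k) (sch.side k) r.curvature.F r.curvature.F (t * M ^ n k))
        atTop (𝓝 c)) →
    Tendsto (fun k => ((M : ℝ) ^ n k) ^ 8 *
      latticeConnectedCorr r.ρ (sch.β k) (sch.side k) r.curvature.F r.curvature.F (M ^ n k))
        atTop (𝓝 θ) →
    HasLatticeMassGap r sch Δ → ScaledFiniteSize r M sch n

/-- **Stub statement — UV REGULARITY of the limits (open).** The old `LimitRegularity` with the approximate
reflection positivity `ARP` of the canonical curvature distributions added to its conclusion: along a
crux-admissible sequence whose canonical curvature functions converge on products, `UVB ∧ AsympEuclid ∧ ARP ∧ ND2 ∧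
ND3` (uniform E0', E1 in the limit, approximate E2 of the time-chiral corner density, non-degenerate two- and
three-point limits). Every conjunct is ultraviolet/universality content (wave-1 determination). -/
def UVRegularity : Prop :=
  ∀ (G : Type) [Group G] [TopologicalSpace G] [IsTopologicalGroup G] [CompactSpace G]
    [MeasurableSpace G] [BorelSpace G], IsCompactSimpleLieGroup G →
    ∀ (r : LatticeRep G) (M : ℕ) (θ Δ : ℝ) (sch : SpeciesScheme (YMSpecies G)) (n : ℕ → ℕ),
    0 < θ → 0 < Δ → (∀ k, sch.a k = ((M : ℝ) ^ n k)⁻¹) → Tendsto sch.β atTop atTop →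
    (∀ t : ℕ, 0 < t → ∃ c : ℝ, Tendsto (fun k => ((M : ℝ) ^ n k) ^ 8 *
      latticeConnectedCorr r.ρ (sch.β k) (sch.side k) r.curvature.F r.curvature.F (t * M ^ n k))
        atTop (𝓝 c)) →
    Tendsto (fun k => ((M : ℝ) ^ n k) ^ 8 *
      latticeConnectedCorr r.ρ (sch.β k) (sch.side k) r.curvature.F r.curvature.F (M ^ n k))
        atTop (𝓝 θ) →
    HasLatticeMassGap r sch Δ → ConvProducts r sch →
      UVB r sch ∧ AsympEuclid r sch ∧ ARP r sch ∧ ND2 r sch ∧ ND3 r sch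

/-- **Stub statement — CLUSTERING LEG (IR; open).** Along a crux-admissible sequence with convergent canonical
products and uniform E0' bounds, the canonical curvature distributions cluster in space `k`-uniformly (`UCL`, the
E4 input of the packaging): the SCALED, `k`-uniform form of the lattice gap that hypothesis (ii) (per observable
pair, unscaled) does not supply by itself. -/
def ClusteringLeg : Prop :=
  ∀ (G : Type) [Group G] [TopologicalSpace G] [IsTopologicalGroup G] [CompactSpace G]
    [MeasurableSpace G] [BorelSpace G], IsCompactSimpleLieGroup G →
    ∀ (r : LatticeRep G) (M : ℕ) (θ Δ : ℝ) (sch : SpeciesScheme (YMSpecies G)) (n : ℕ → ℕ),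
    0 < θ → 0 < Δ → (∀ k, sch.a k = ((M : ℝ) ^ n k)⁻¹) → Tendsto sch.β atTop atTop →
    (∀ t : ℕ, 0 < t → ∃ c : ℝ, Tendsto (fun k => ((M : ℝ) ^ n k) ^ 8 *
      latticeConnectedCorr r.ρ (sch.β k) (sch.side k) r.curvature.F r.curvature.F (t * M ^ n k))
        atTop (𝓝 c)) →
    Tendsto (fun k => ((M : ℝ) ^ n k) ^ 8 *
      latticeConnectedCorr r.ρ (sch.β k) (sch.side k) r.curvature.F r.curvature.F (M ^ n k))
        atTop (𝓝 θ) →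
    HasLatticeMassGap r sch Δ → ConvProducts r sch → UVB r sch → UCL r sch

/-- **Stub statement — ONE-FIELD OS LEGS, corrected (proved downstream in the `…StubOSLegs{A,B,C,D}` files).**
Full-sequence convergence on products + uniform E0' + asymptotic Euclidean invariance + approximate RP + uniform
spatial clustering + the two non-degeneracy witnesses ⇒ OS data `T` over all species (zero-extension of the
one-field family) with `IsYangMillsFor r (canon r sch) T`, non-trivial and non-Gaussian in `tr F²`. -/
def OneFieldOSLegs' : Prop :=
  ∀ (G : Type) [Group G] [TopologicalSpace G] [IsTopologicalGroup G] [CompactSpace G]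
    [MeasurableSpace G] [BorelSpace G] (r : LatticeRep G) (sch : SpeciesScheme (YMSpecies G)),
    ConvProducts r sch → UVB r sch → AsympEuclid r sch → ARP r sch → UCL r sch → ND2 r sch → ND3 r sch →
      ∃ T : OSData (YMSpecies G) 4,
        IsYangMillsFor r (canon r sch) T ∧ T.IsNontrivial r.curvature ∧ T.IsNonGaussian r.curvature

end Summit.QuantumFields.YangMills.Cruxes.ContinuumLimitOnTrajectory.TwoOrbitSynchronisation

end
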